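import Summits.Ventures.PercRepro.MSRMStarPair

/-!
# The pair lemma, part 2: the residue mixed class is empty

Dossier proofs/MINE1-theoremS.md, Addendum 63. In the mixed class of a residue instance
(`MixedII r F (u.erase r)`, Addendum 62 suppl. 2) take a member `A ⊇ ū` of maximum cardinality
(`exists_max_member_above_ubar`). If `A ∩ u₀` were free — disjoint from a member, hence from a
minimal member `m` — then: `ū ⊆ m`, for otherwise (ABS) at some `z ∈ ū ∖ m` enlarges `A`; no
`z ∈ A ∩ u₀` is of type (n), for the same reason; no `z' ∈ m ∩ u₀` is of type (s), by the
minimality of `m ⊇ ū ≠ ∅`. If some `z' ∈ m ∩ u₀` is of type (n), absorbing the singleton members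
`{z}`, `z ∈ A ∩ u₀`, into `m` one at a time shows that not all of them can be of type (s), so
some `z ∈ A ∩ u₀` is of type (c); if every `z' ∈ m ∩ u₀` is of type (c), then `S' ∖ z' ⊇ A` forces
`A = S' ∖ z'`, and (‡) again yields a `z ∈ A ∩ u₀` of type (c). With `E := S' ∖ z ∈ K`, `ū ⊆ E`,
either `E ∩ u₀` is non-free — and `(u₀ ∖ E, E)` is a complementary pair (`false_of_cstar_partner`)
— or a member lies inside `ū ∪ {z}`, and `(u₀ ∖ z, ū ∪ {z})` is a complementary pair. Either way
validity fails: **the residue mixed class is empty** (`MixedII.residue_false`), so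
`CaseIOfComplex α` holds as soon as every residue instance has `u ≠ univ`
(`caseIOfComplex_of_residue_ne_univ`).
-/

namespace PercRepro.MSTight

open Finset
open scoped FinsetFamily

variable {α : Type*} [DecidableEq α] [Fintype α]

section Main

variable {F : Finset (Finset α)} {u : Finset α} {r : α}

/-- Elements of `ū = ubar r (u.erase r)` are the elements outside `u`. -/
theorem mem_compl_of_mem_ubar (hru : r ∈ u) {z : α} (hz : z ∈ ubar r (u.erase r)) :
    z ∈ univ \ u := by
  rw [ubar_erase_eq hru] at hz
  exact hz

/-- A member avoiding `r` has an element of `u₀` (no member lies inside `ū`). -/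
theorem exists_mem_erase_of_mem_part0 (hM : MixedII r F (u.erase r)) {m : Finset α}
    (hm : m ∈ part0 r F) : ∃ a ∈ m, a ∈ u.erase r := by
  by_contra hno
  simp only [not_exists, not_and] at hno
  apply hM.ubar_notMem_part0
  refine hM.monotone.2 m hm _ hM.ubar_mem_proj fun a ha => ?_
  exact mem_ubar.2 ⟨fun e => (mem_part0.1 hm).2 (e ▸ ha), hno a ha⟩

/-- **Step 0 and the choice of `A`**: a member containing `ū` of maximum cardinality. -/
theorem exists_max_member_above_ubar (h : Residue F u) (hM : MixedII r F (u.erase r))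
    (hru : r ∈ u) :
    ∃ A ∈ part0 r F, ubar r (u.erase r) ⊆ A ∧
      ∀ B ∈ part0 r F, ubar r (u.erase r) ⊆ B → A ⊆ B → B = A := by
  set T := (part0 r F).filter (fun A => ubar r (u.erase r) ⊆ A) with hT
  have hTne : T.Nonempty := by
    obtain ⟨t, ht, hrt⟩ := hM.core r
    have ht0 : t ∈ part0 r F := mem_part0.2 ⟨ht, hrt⟩
    obtain ⟨m, hm, -⟩ := exists_isMinIn_subset ht0
    by_cases hsub : ubar r (u.erase r) ⊆ m
    · exact ⟨m, mem_filter.2 ⟨hm.1, hsub⟩⟩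
    · obtain ⟨z, hz, hzm⟩ := not_subset.1 hsub
      have hzc := mem_compl_of_mem_ubar hru hz
      have h1 : ubar r (u.erase r) ∪ m ∈ proj r F :=
        union_isMinIn_mem_proj hM.tightP hM.singleton_mem hM.sing
          (nonTightening_of_mem_compl h hM hru hzc)
          ⟨{r}, singleton_r_mem_partner_of_mem_compl hM hru hzc⟩ hM.ubar_mem_proj hz hm hzm
      have h2 : ubar r (u.erase r) ∪ m ∈ part0 r F :=
        hM.monotone.2 m hm.1 _ h1 subset_union_right
      exact ⟨_, mem_filter.2 ⟨h2, subset_union_left⟩⟩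
  obtain ⟨A, hA, hAmax⟩ := exists_max_image T card hTne
  refine ⟨A, (mem_filter.1 hA).1, (mem_filter.1 hA).2, fun B hB hubB hAB => ?_⟩
  have hBT : B ∈ T := mem_filter.2 ⟨hB, hubB⟩
  exact (eq_of_subset_of_card_le hAB (hAmax B hBT)).symm

/-- **A C*-only partner member above `ū` is impossible**: `(u₀ ∖ k, k)` would be a complementary
pair. -/
theorem false_of_cstar_partner (hM : MixedII r F (u.erase r)) {k : Finset α}
    (hk1 : k ∈ partr r F) (hk0 : k ∈ part0 r F) (hubk : ubar r (u.erase r) ⊆ k)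
    (hY : k ∩ u.erase r ∉ diffsY r F) : False := by
  have ht := hM.sdiff_witness_mem_partr hk1 hY
  refine hM.valid _ ht _ hk0 ?_ ?_
  · exact Finset.disjoint_left.2 fun a ha hak =>
      (mem_sdiff.1 ha).2 (mem_inter.2 ⟨hak, (mem_sdiff.1 ha).1⟩)
  · ext a
    constructor
    · intro ha
      rcases mem_union.1 ha with ha | hak
      · exact mem_erase.2 ⟨(mem_erase.1 (mem_sdiff.1 ha).1).1, mem_univ a⟩
      · exact mem_erase.2 ⟨fun e => (mem_part0.1 hk0).2 (e ▸ hak), mem_univ a⟩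
    · intro ha
      have har : a ≠ r := (mem_erase.1 ha).1
      by_cases hau : a ∈ u.erase r
      · by_cases hak : a ∈ k
        · exact mem_union_right _ hak
        · exact mem_union_left _ (mem_sdiff.2 ⟨hau, fun h' => hak (mem_inter.1 h').1⟩)
      · exact mem_union_right _ (hubk (mem_ubar.2 ⟨har, hau⟩))

/-- **THE PAIR LEMMA, in its final form: the residue mixed class is empty.** -/
theorem MixedII.residue_false (h : Residue F u) (hM : MixedII r F (u.erase r)) (hru : r ∈ u) :
    False := by
  obtain ⟨A, hA0, hubA, hmax⟩ := exists_max_member_above_ubar h hM hru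
  have hP := hM.tightP
  have hr := hM.singleton_mem
  have hsing := hM.sing
  have hup := hM.monotone.2
  have hdown := hM.monotone.1
  have hAP : A ∈ proj r F := RMStar.mem_proj_of_mem_part0 hA0
  have hrA : r ∉ A := (mem_part0.1 hA0).2
  obtain ⟨z₀, hz₀⟩ := hM.ubar_nonempty
  have hA1 : A ∈ partr r F :=
    mem_partr_of_mem_proj_of_mem_compl h hM hru hAP (mem_compl_of_mem_ubar hru hz₀) (hubA hz₀)
  -- the conflict: a minimal member `m` disjoint from `A ∩ u₀`
  by_cases hY : A ∩ u.erase r ∈ diffsY r F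
  swap
  · exact false_of_cstar_partner hM hA1 hA0 hubA hY
  obtain ⟨t', -, s, hs, heq⟩ := Finset.mem_diffs.1 hY
  have hdisj : ∀ a ∈ s, a ∈ u.erase r → a ∉ A := by
    intro a has hau haA
    have h1 : a ∈ A ∩ u.erase r := mem_inter.2 ⟨haA, hau⟩
    rw [← heq] at h1
    exact (mem_sdiff.1 h1).2 has
  obtain ⟨m, hm, hms⟩ := exists_isMinIn_subset hs
  have hm0 : m ∈ part0 r F := hm.1
  have hrm : r ∉ m := (mem_part0.1 hm0).2
  have hconf : ∀ a ∈ m, a ∈ u.erase r → a ∉ A := fun a ham => hdisj a (hms ham)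
  obtain ⟨z', hz'm, hz'u⟩ := exists_mem_erase_of_mem_part0 hM hm0
  have hz'A : z' ∉ A := hconf z' hz'm hz'u
  -- absorbing `m` into `A` contradicts the maximality of `A`
  have noabs : ∀ z ∈ A, z ∉ m → (diffsX z F ∩ diffsY z F).card = (partner z F).card →
      (partner z F).Nonempty → False := by
    intro z hzA hzm hε hK
    have h1 : A ∪ m ∈ proj r F := union_isMinIn_mem_proj hP hr hsing hε hK hAP hzA hm hzm
    have h2 : A ∪ m ∈ part0 r F := hup A hA0 _ h1 subset_union_left
    have h3 := hmax _ h2 (hubA.trans subset_union_left) subset_union_left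
    exact hz'A (h3 ▸ mem_union_right A hz'm)
  -- Step 2: `ū ⊆ m`
  have hubm : ubar r (u.erase r) ⊆ m := by
    intro z hz
    by_contra hzm
    have hzc := mem_compl_of_mem_ubar hru hz
    exact noabs z (hubA hz) hzm (nonTightening_of_mem_compl h hM hru hzc)
      ⟨{r}, singleton_r_mem_partner_of_mem_compl hM hru hzc⟩
  -- Step 3: every `z ∈ A ∩ u₀` is of type (s) or (c)
  have hAtype : ∀ z ∈ A, z ∈ u.erase r →
      ({z} : Finset α) ∈ part0 r F ∨ (univ.erase z).erase r ∈ partr r F := by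
    intro z hzA hzu
    rcases type_trichotomy h hr hsing (mem_erase.1 hzu).1 with ⟨hnt, hK⟩ | h2
    · exfalso
      have hzm : z ∉ m := fun hzm => hconf z hzm hzu hzA
      exact noabs z hzA hzm (nonTightening_count h.hexc hnt) hK
    · exact h2
  -- Step 4: every `z' ∈ m ∩ u₀` is of type (n) or (c)
  have hmtype : ∀ z ∈ m, z ∈ u.erase r →
      (¬ Tight (proj z F) ∧ (partner z F).Nonempty) ∨ (univ.erase z).erase r ∈ partr r F := by
    intro z hzm hzu
    rcases type_trichotomy h hr hsing (mem_erase.1 hzu).1 with h1 | hs1 | hc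
    · exact Or.inl h1
    · exfalso
      have h2 : ({z} : Finset α) = m := hm.2 _ hs1 (singleton_subset_iff.2 hzm)
      have h3 : z₀ ∈ ({z} : Finset α) := h2 ▸ hubm hz₀
      rw [mem_singleton] at h3
      exact (mem_ubar.1 hz₀).2 (h3 ▸ hzu)
    · exact Or.inr hc
  -- Steps 5 and 6: some `z ∈ A ∩ u₀` is of type (c)
  have hexists : ∃ z ∈ A, z ∈ u.erase r ∧ (univ.erase z).erase r ∈ partr r F := by
    by_contra hno
    simp only [not_exists, not_and] at hno
    have hS : ∀ z ∈ A, z ∈ u.erase r → ({z} : Finset α) ∈ part0 r F := fun z hzA hzu =>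
      (hAtype z hzA hzu).resolve_right (hno z hzA hzu)
    rcases hmtype z' hz'm hz'u with ⟨hnt, hK⟩ | hc
    · -- Step 5: absorb the singleton members of `A ∩ u₀` into `m`
      have hε := nonTightening_count h.hexc hnt
      have key : ∀ S : Finset α, S ⊆ A ∩ u.erase r → m ∪ S ∈ proj r F := by
        intro S
        induction S using Finset.induction_on with
        | empty => intro _; rw [union_empty]; exact RMStar.mem_proj_of_mem_part0 hm0
        | insert a S haS ih =>
          intro hsub
          have haA : a ∈ A ∩ u.erase r := hsub (mem_insert_self a S)
          have ih' := ih ((subset_insert a S).trans hsub)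
          have hsa := hS a (mem_inter.1 haA).1 (mem_inter.1 haA).2
          have hmin := isMinIn_singleton hM.empty_notMem hsa
          have hz'S : z' ∈ m ∪ S := mem_union_left S hz'm
          have hz'a : z' ∉ ({a} : Finset α) := by
            rw [mem_singleton]
            rintro rfl
            exact hz'A (mem_inter.1 haA).1
          have h1 := union_isMinIn_mem_proj hP hr hsing hε hK ih' hz'S hmin hz'a
          rw [union_assoc, union_comm S, ← insert_eq] at h1
          exact h1
      have hall := key (A ∩ u.erase r) (subset_refl _)
      have hsub : m ∪ A ⊆ m ∪ A ∩ u.erase r := by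
        intro a ha
        rcases mem_union.1 ha with ham | haA
        · exact mem_union_left _ ham
        · by_cases hau : a ∈ u.erase r
          · exact mem_union_right _ (mem_inter.2 ⟨haA, hau⟩)
          · exact mem_union_left _ (hubm (mem_ubar.2 ⟨fun e => hrA (e ▸ haA), hau⟩))
      have h1 : m ∪ A ∈ proj r F := mem_proj_of_subset hP hr hsing hall hsub
      have h2 : m ∪ A ∈ part0 r F := hup A hA0 _ h1 subset_union_right
      have h3 := hmax _ h2 (hubA.trans subset_union_right) subset_union_right
      exact hz'A (h3 ▸ mem_union_left A hz'm)
    · -- Step 6: `A = S' ∖ z'`, and (‡) forces `u₀ ⊆ t₁`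
      have hAE : A ⊆ (univ.erase z').erase r := fun a ha =>
        mem_erase.2 ⟨fun e => hrA (e ▸ ha), mem_erase.2 ⟨fun e => hz'A (e ▸ ha), mem_univ a⟩⟩
      have hE0 : (univ.erase z').erase r ∈ part0 r F :=
        hup A hA0 _ (RMStar.mem_proj_of_mem_partr hc) hAE
      have hEA := hmax _ hE0 (hubA.trans hAE) hAE
      obtain ⟨t₁, ht₁, hYt⟩ := hM.cstar_only
      have hsub : u.erase r ⊆ t₁ := by
        intro a hau
        have har : a ≠ r := (mem_erase.1 hau).1
        by_cases haz : a = z'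
        · subst haz
          obtain ⟨b, hb, hbm⟩ := Finset.not_disjoint_iff.1 (hM.witness_meets ht₁ hYt hm0)
          have hbA : b ∉ A := hconf b hbm (mem_inter.1 hb).2
          rw [← hEA] at hbA
          have hbz : b = a := by
            by_contra hne
            exact hbA (mem_erase.2 ⟨(mem_erase.1 (mem_inter.1 hb).2).1, mem_erase.2 ⟨hne, mem_univ b⟩⟩)
          exact hbz ▸ (mem_inter.1 hb).1
        · have haA : a ∈ A := by
            rw [← hEA]
            exact mem_erase.2 ⟨har, mem_erase.2 ⟨haz, mem_univ a⟩⟩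
          obtain ⟨b, hb, hba⟩ :=
            Finset.not_disjoint_iff.1 (hM.witness_meets ht₁ hYt (hS a haA hau))
          rw [mem_singleton] at hba
          exact hba ▸ (mem_inter.1 hb).1
      exact hM.u0_notMem_proj
        (mem_proj_of_subset hP hr hsing (RMStar.mem_proj_of_mem_partr ht₁) hsub)
  -- Step 7: `E = S' ∖ z` is a partner member above `ū`
  obtain ⟨z, hzA, hzu, hc⟩ := hexists
  have hzr : z ≠ r := (mem_erase.1 hzu).1
  have hzm : z ∉ m := fun hzm => hconf z hzm hzu hzA
  have hEP : (univ.erase z).erase r ∈ proj r F := RMStar.mem_proj_of_mem_partr hc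
  have hmE : m ⊆ (univ.erase z).erase r := fun a ha =>
    mem_erase.2 ⟨fun e => hrm (e ▸ ha), mem_erase.2 ⟨fun e => hzm (e ▸ ha), mem_univ a⟩⟩
  have hE0 : (univ.erase z).erase r ∈ part0 r F := hup m hm0 _ hEP hmE
  have hubE : ubar r (u.erase r) ⊆ (univ.erase z).erase r := fun a ha =>
    mem_erase.2 ⟨(mem_ubar.1 ha).1, mem_erase.2 ⟨fun e => (mem_ubar.1 ha).2 (e ▸ hzu), mem_univ a⟩⟩
  by_cases hYE : (univ.erase z).erase r ∩ u.erase r ∈ diffsY r F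
  swap
  · exact false_of_cstar_partner hM hc hE0 hubE hYE
  -- a member inside `ū ∪ {z}`: `(u₀ ∖ z, ū ∪ {z})` is a complementary pair
  obtain ⟨t'', -, s', hs', heq'⟩ := Finset.mem_diffs.1 hYE
  have hs'sub : s' ⊆ insert z (ubar r (u.erase r)) := by
    intro a ha
    have har : a ≠ r := fun e => (mem_part0.1 hs').2 (e ▸ ha)
    by_cases haz : a = z
    · rw [haz]; exact mem_insert_self z _
    · refine mem_insert_of_mem (mem_ubar.2 ⟨har, fun hau => ?_⟩)
      have h1 : a ∈ (univ.erase z).erase r ∩ u.erase r :=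
        mem_inter.2 ⟨mem_erase.2 ⟨har, mem_erase.2 ⟨haz, mem_univ a⟩⟩, hau⟩
      rw [← heq'] at h1
      exact (mem_sdiff.1 h1).2 ha
  have hzubP : insert z (ubar r (u.erase r)) ∈ proj r F :=
    mem_proj_of_subset hP hr hsing hAP (insert_subset hzA hubA)
  have hzub0 : insert z (ubar r (u.erase r)) ∈ part0 r F := hup s' hs' _ hzubP hs'sub
  have htP : (u.erase r).erase z ∈ proj r F := by
    refine mem_proj_of_subset hP hr hsing hEP fun a ha => ?_
    exact mem_erase.2 ⟨(mem_erase.1 (mem_erase.1 ha).2).1,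
      mem_erase.2 ⟨(mem_erase.1 ha).1, mem_univ a⟩⟩
  have ht1 : (u.erase r).erase z ∈ partr r F := hdown _ hc _ htP fun a ha =>
    mem_erase.2 ⟨(mem_erase.1 (mem_erase.1 ha).2).1,
      mem_erase.2 ⟨(mem_erase.1 ha).1, mem_univ a⟩⟩
  refine hM.valid _ ht1 _ hzub0 ?_ ?_
  · refine Finset.disjoint_left.2 fun a ha ha' => ?_
    rcases mem_insert.1 ha' with rfl | ha'
    · exact (mem_erase.1 ha).1 rfl
    · exact (mem_ubar.1 ha').2 (mem_erase.1 ha).2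
  · ext a
    constructor
    · intro ha
      rcases mem_union.1 ha with ha | ha
      · exact mem_erase.2 ⟨(mem_erase.1 (mem_erase.1 ha).2).1, mem_univ a⟩
      · rcases mem_insert.1 ha with rfl | ha
        · exact mem_erase.2 ⟨(mem_erase.1 hzu).1, mem_univ _⟩
        · exact mem_erase.2 ⟨(mem_ubar.1 ha).1, mem_univ a⟩
    · intro ha
      have har : a ≠ r := (mem_erase.1 ha).1
      by_cases haz : a = z
      · rw [haz]; exact mem_union_right _ (mem_insert_self z _)
      · by_cases hau : a ∈ u.erase r
        · exact mem_union_left _ (mem_erase.2 ⟨haz, hau⟩)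
        · exact mem_union_right _ (mem_insert_of_mem (mem_ubar.2 ⟨har, hau⟩))

/-- **`CaseIOfComplex α` holds as soon as every residue instance has `u ≠ univ`**: at a complex
tight trace `r ∈ u` with `u ∖ r ∉ F`, `MixedII.of_residue` would put the instance into the mixed
class, which is empty. -/
theorem caseIOfComplex_of_residue_ne_univ (hU : ∀ (F : Finset (Finset α)) (u : Finset α),
    Residue F u → u ≠ univ) : CaseIOfComplex α := by
  intro F u r h hP hru hr
  by_contra hI
  exact MixedII.residue_false h (MixedII.of_residue h hP hr hru (hU F u h) hI) hru

end Main

end PercRepro.MSTight
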